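import Mathlib
import Literature.RepresentationTheory.FiniteGroups.WedderburnBlocks
import Literature.RepresentationTheory.FiniteGroups.FourierInversionIdentity

/-!
# `GradedPricing`, line `fourier-support-repfun`: `stub_support` (the Fourier-support lemma)

Crux `stmt-MatrixMultiplication-7611` (`Summit.MatrixMultiplication.MatrixMultiplication.Theses.
LevelGradedCohnUmans.GradedPricing`, the finite-group `R_sep` form of Blasiak–Cohn–Grochow–Pratt–Umans
2024, Thm 2.2), line `fourier-support-repfun`, registered stub `stub_support` — the hardest stub and the
only place where BI-invariance of the test space `J ≤ ℂ^G` is used (two-sidedly).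

The lever is the inversion-twisted lift `f ↦ f̌ := Σ_g f(g⁻¹)·g ∈ ℂ[G]`, spelled out as
`∑ g, MonoidAlgebra.single g (f g⁻¹)` in every statement so that nothing but existing declarations
appears in the signatures.  For a Wedderburn isomorphism `φ : ℂ[G] ≃ₐ ∏ᵢ ℂ^{dᵢ×dᵢ}`
(`Literature.RepresentationTheory.FiniteGroups.BlockAlgebraC`, `exists_algEquiv_pi_matrix`):

* `coeff_one_invLift_mul_single` — the read-out is a coefficient: `(f̌ · g).coeff 1 = f g`;
* `single_mul_invLift_mul_single` — bi-translation is two-sided multiplication: `a · ȟ · b = ǩ`,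
  `k x = h (b x a)`;
* `card_mul_apply_eq_sum_trace` — Fourier inversion at `1` (tree `card_mul_coeff_one_eq_sum_trace`):
  `|G| · f g = Σᵢ dᵢ · tr (φ(f̌)ᵢ · φ(g)ᵢ)`;
* `exists_mul_lift_mul_eq` — for a bi-invariant `J`, `J̌` is closed under `u · (·) · v`
  (`MonoidAlgebra.induction_linear` twice + the previous identity);
* `stub_support` — if `f ∈ J` has a non-zero `i`-th Fourier coefficient `φ(f̌)ᵢ`, then the block
  character `χᵢ = (blockRep φ i).character` lies in `J`: pick a non-zero entry `(a, b)`; the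
  sandwiches `φ⁻¹(E_ca) · f̌ · φ⁻¹(E_bc)` are lifts of elements `k_c ∈ J` with
  `φ(ǩ_c) = φ(f̌)ᵢ[a,b] · E_cc` in block `i` (`Matrix.single_mul_mul_single`); their sum lifts to
  `N · eᵢ`, so `k₀ := N⁻¹ Σ_c k_c ∈ J` lifts to the block unit `eᵢ`, and Fourier inversion at `1`
  gives `|G| · k₀ = dᵢ · χᵢ` (`character_blockRep_apply`), `dᵢ ≠ 0`.

Proof scripts: the planner's closed scratch of the line (`line-fourier-support-repfun-closed.lean`,
evidence on the crux item; reproduced in `Cruxes/GradedPricing/Lines/fourier-support-repfun.md`).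
-/

set_option linter.dupNamespace false

noncomputable section

namespace Summit.MatrixMultiplication.MatrixMultiplication.Theorems.GradedPricing

open scoped BigOperators
open Literature.RepresentationTheory.FiniteGroups

variable {G : Type} [Group G]
variable {r : ℕ} {d : Fin r → ℕ}

/-! ## Convention identities of the lever `f̌ = ∑ g, single g (f g⁻¹)` -/

/-- The read-out functional is a coefficient of a product: `(f̌ · g).coeff 1 = f(g)`. -/
theorem coeff_one_invLift_mul_single [Fintype G] (f : G → ℂ) (g : G) :
    ((∑ h : G, MonoidAlgebra.single h (f h⁻¹)) * MonoidAlgebra.single g 1).coeff 1 = f g := by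
  classical
  simp only [Finset.sum_mul, MonoidAlgebra.single_mul_single, mul_one,
    MonoidAlgebra.coeff_sum, MonoidAlgebra.coeff_single, Finset.sum_apply', Finsupp.single_apply]
  rw [Finset.sum_eq_single g⁻¹]
  · simp
  · intro h _ hne
    rw [if_neg]
    intro e
    exact hne (eq_inv_of_mul_eq_one_left e)
  · simp

/-- Bi-translation becomes two-sided multiplication: `a · ȟ · b = ǩ` with `k(x) = h(b x a)`; so a
bi-invariant `J` has a two-sided-closed image `J̌` (THE step where bi-invariance is consumed; with
`a = 1` only — left-invariance — one gets a right ideal, cf. the landed negative lemma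
`gradedPricing_false_with_leftInv_only`). -/
theorem single_mul_invLift_mul_single [Fintype G] (h : G → ℂ) (a b : G) :
    MonoidAlgebra.single a 1 * (∑ x : G, MonoidAlgebra.single x (h x⁻¹)) * MonoidAlgebra.single b 1 =
      ∑ x : G, MonoidAlgebra.single x ((fun y => h (b * y * a)) x⁻¹) := by
  simp only [Finset.mul_sum, Finset.sum_mul, MonoidAlgebra.single_mul_single, one_mul, mul_one]
  exact Fintype.sum_equiv ((Equiv.mulLeft a).trans (Equiv.mulRight b)) _ _ fun x => by
    simp [mul_assoc]

/-- Read-out = trace form (Fourier inversion at `1`, tree `card_mul_coeff_one_eq_sum_trace`):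
`|G| · f(g) = ∑_i d_i · tr (φ(f̌)_i · φ(g)_i)`. -/
theorem card_mul_apply_eq_sum_trace [Fintype G]
    (φ : MonoidAlgebra ℂ G ≃ₐ[ℂ] BlockAlgebraC d) (f : G → ℂ) (g : G) :
    (Fintype.card G : ℂ) * f g =
      ∑ i, (d i : ℂ) * Matrix.trace (φ (∑ h : G, MonoidAlgebra.single h (f h⁻¹)) i *
        φ (MonoidAlgebra.single g 1) i) := by
  have h := card_mul_coeff_one_eq_sum_trace φ
    ((∑ h : G, MonoidAlgebra.single h (f h⁻¹)) * MonoidAlgebra.single g 1)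
  rw [coeff_one_invLift_mul_single] at h
  rw [h]
  simp only [map_mul, Pi.mul_apply]

/-! ## Linearity of the lift and two-sidedness of `J̌` -/

/-- Additivity of the lift `k ↦ ǩ`. -/
theorem lift_add [Fintype G] (k k' : G → ℂ) :
    (∑ g : G, MonoidAlgebra.single g ((k + k') g⁻¹)) =
      (∑ g : G, MonoidAlgebra.single g (k g⁻¹)) + ∑ g : G, MonoidAlgebra.single g (k' g⁻¹) := by
  simp only [Pi.add_apply, MonoidAlgebra.single_add, Finset.sum_add_distrib]

/-- Homogeneity of the lift `k ↦ ǩ`. -/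
theorem lift_smul [Fintype G] (c : ℂ) (k : G → ℂ) :
    (∑ g : G, MonoidAlgebra.single g ((c • k) g⁻¹)) =
      c • ∑ g : G, MonoidAlgebra.single g (k g⁻¹) := by
  simp only [Pi.smul_apply, smul_eq_mul, Finset.smul_sum, MonoidAlgebra.smul_single']

/-- The lift of `0` is `0`. -/
theorem lift_zero [Fintype G] :
    (∑ g : G, MonoidAlgebra.single g ((0 : G → ℂ) g⁻¹)) = 0 := by
  simp only [Pi.zero_apply, MonoidAlgebra.single_zero, Finset.sum_const_zero]

/-- The lift commutes with finite sums. -/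
theorem lift_sum [Fintype G] {ι : Type*} (s : Finset ι) (k : ι → G → ℂ) :
    (∑ g : G, MonoidAlgebra.single g ((∑ c ∈ s, k c) g⁻¹)) =
      ∑ c ∈ s, ∑ g : G, MonoidAlgebra.single g (k c g⁻¹) := by
  classical
  induction s using Finset.induction_on with
  | empty => rw [Finset.sum_empty, Finset.sum_empty]; exact lift_zero
  | insert a s ha ih => rw [Finset.sum_insert ha, Finset.sum_insert ha, lift_add, ih]

/-- **Two-sidedness of `J̌`** (the step consuming bi-invariance): for `k ∈ J` and arbitrary
`u, v ∈ ℂ[G]`, `u · ǩ · v` is again the lift of an element of `J`. -/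
theorem exists_mul_lift_mul_eq [Fintype G] (J : Submodule ℂ (G → ℂ))
    (hJ : ∀ f ∈ J, ∀ a b : G, (fun g : G => f (a * g * b)) ∈ J)
    (u v : MonoidAlgebra ℂ G) {k : G → ℂ} (hk : k ∈ J) :
    ∃ k' ∈ J, u * (∑ g : G, MonoidAlgebra.single g (k g⁻¹)) * v =
      ∑ g : G, MonoidAlgebra.single g (k' g⁻¹) := by
  induction u using MonoidAlgebra.induction_linear with
  | zero => exact ⟨0, J.zero_mem, by rw [zero_mul, zero_mul, lift_zero]⟩
  | add u u' hu hu' =>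
    obtain ⟨k₁, hk₁, h₁⟩ := hu
    obtain ⟨k₂, hk₂, h₂⟩ := hu'
    exact ⟨k₁ + k₂, J.add_mem hk₁ hk₂, by rw [add_mul, add_mul, h₁, h₂, lift_add]⟩
  | single a c =>
    induction v using MonoidAlgebra.induction_linear with
    | zero => exact ⟨0, J.zero_mem, by rw [mul_zero, lift_zero]⟩
    | add v v' hv hv' =>
      obtain ⟨k₁, hk₁, h₁⟩ := hv
      obtain ⟨k₂, hk₂, h₂⟩ := hv'
      exact ⟨k₁ + k₂, J.add_mem hk₁ hk₂, by rw [mul_add, h₁, h₂, lift_add]⟩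
    | single b c' =>
      refine ⟨(c * c') • fun x => k (b * x * a), J.smul_mem _ (hJ k hk b a), ?_⟩
      rw [lift_smul, ← single_mul_invLift_mul_single k a b,
        show MonoidAlgebra.single a c = c • MonoidAlgebra.single a (1 : ℂ) by
          rw [MonoidAlgebra.smul_single', mul_one],
        show MonoidAlgebra.single b c' = c' • MonoidAlgebra.single b (1 : ℂ) by
          rw [MonoidAlgebra.smul_single', mul_one],
        smul_mul_assoc, smul_mul_assoc, mul_smul_comm, smul_smul]

/-- `Σ_c E_cc N = N • 1` in `ℂ^{n×n}`. -/
theorem sum_single_diag {n : ℕ} (N : ℂ) :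
    ∑ c : Fin n, Matrix.single c c N = N • (1 : Matrix (Fin n) (Fin n) ℂ) := by
  ext x y
  rw [Matrix.sum_apply, Matrix.smul_apply, Matrix.one_apply, smul_eq_mul, mul_ite, mul_one,
    mul_zero]
  by_cases hxy : x = y
  · subst hxy
    rw [if_pos rfl, Finset.sum_eq_single x, Matrix.single_apply, if_pos ⟨rfl, rfl⟩]
    · intro c _ hc
      rw [Matrix.single_apply, if_neg]
      exact fun h => hc h.1
    · exact fun h => absurd (Finset.mem_univ x) h
  · rw [if_neg hxy]
    refine Finset.sum_eq_zero fun c _ => ?_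
    rw [Matrix.single_apply, if_neg]
    rintro ⟨h1, h2⟩
    exact hxy (h1.symm.trans h2)

/-! ## The registered stub -/

/-- **`stub_support` — the Fourier-support lemma** (crux `GradedPricing`, line
`fourier-support-repfun`).  If `J ≤ ℂ^G` is bi-invariant and some `f ∈ J` has a non-zero `i`-th
Fourier coefficient `φ(f̌)ᵢ ≠ 0` (`f̌ = ∑ g, single g (f g⁻¹)`), then the block character
`χᵢ = (blockRep φ i).character` lies in `J`.  Proof: a non-zero entry `(a,b)` of `φ(f̌)ᵢ`; the
sandwiches `φ⁻¹(Eᵢ_ca) · f̌ · φ⁻¹(Eᵢ_bc)` are lifts of elements of `J` (`exists_mul_lift_mul_eq`)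
and equal `φ(f̌)ᵢ[a,b] · Eᵢ_cc` (`Matrix.single_mul_mul_single`); summing over `c` and normalising
gives `k₀ ∈ J` with `φ(ǩ₀) = eᵢ`; Fourier inversion at `1` (`card_mul_apply_eq_sum_trace`,
`character_blockRep_apply`) gives `|G| · k₀ = dᵢ · χᵢ`, and `dᵢ ≠ 0`. -/
theorem stub_support {G : Type} [Group G] [Fintype G] {r : ℕ} {d : Fin r → ℕ} [∀ i, NeZero (d i)]
    (φ : MonoidAlgebra ℂ G ≃ₐ[ℂ] Literature.RepresentationTheory.FiniteGroups.BlockAlgebraC d)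
    (J : Submodule ℂ (G → ℂ)) (hJ : ∀ f ∈ J, ∀ a b : G, (fun g : G => f (a * g * b)) ∈ J)
    {f : G → ℂ} (hf : f ∈ J) {i : Fin r}
    (hi : φ (∑ g : G, MonoidAlgebra.single g (f g⁻¹)) i ≠ 0) :
    (Literature.RepresentationTheory.FiniteGroups.blockRep φ i).character ∈ J := by
  classical
  -- (1) a non-zero entry `(a, b)` of the `i`-th Fourier coefficient
  obtain ⟨a, b, hab⟩ : ∃ a b, φ (∑ g : G, MonoidAlgebra.single g (f g⁻¹)) i a b ≠ 0 := by
    by_contra h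
    push Not at h
    exact hi (Matrix.ext fun a b => h a b)
  -- (2) the sandwiches `E_ca · f̌ · E_bc` are lifts of elements of `J` (two-sidedness of `J̌`)
  have hsand : ∀ c : Fin (d i), ∃ k ∈ J,
      φ.symm (Pi.single i (Matrix.single c a 1)) * (∑ g : G, MonoidAlgebra.single g (f g⁻¹)) *
        φ.symm (Pi.single i (Matrix.single b c 1)) = ∑ g : G, MonoidAlgebra.single g (k g⁻¹) :=
    fun c => exists_mul_lift_mul_eq J hJ _ _ hf
  choose k hkJ hk using hsand
  have hφk : ∀ c, φ (∑ g : G, MonoidAlgebra.single g (k c g⁻¹)) =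
      Pi.single i (Matrix.single c c (φ (∑ g : G, MonoidAlgebra.single g (f g⁻¹)) i a b)) := by
    intro c
    rw [← hk c, map_mul, map_mul, AlgEquiv.apply_symm_apply, AlgEquiv.apply_symm_apply,
      ← Pi.single_mul_left, ← Pi.single_mul, Matrix.single_mul_mul_single, one_mul, mul_one]
  -- (3) their sum lifts to `N • e_i`
  have hsum : φ (∑ g : G, MonoidAlgebra.single g ((∑ c, k c) g⁻¹)) =
      (φ (∑ g : G, MonoidAlgebra.single g (f g⁻¹)) i a b) • Pi.single i 1 := by
    rw [lift_sum, map_sum]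
    simp only [hφk]
    funext j
    rw [Finset.sum_apply, Pi.smul_apply]
    by_cases hj : j = i
    · subst hj
      simp only [Pi.single_eq_same]
      exact sum_single_diag _
    · simp only [Pi.single_eq_of_ne hj, Finset.sum_const_zero, smul_zero]
  have hkJ' : (∑ c, k c) ∈ J := J.sum_mem fun c _ => hkJ c
  -- (4) normalise: `k₀ := N⁻¹ • Σ k_c ∈ J` lifts to the block unit `e_i`
  have hlift0 : φ (∑ g : G, MonoidAlgebra.single g
      (((φ (∑ g : G, MonoidAlgebra.single g (f g⁻¹)) i a b)⁻¹ • ∑ c, k c) g⁻¹)) = Pi.single i 1 := by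
    rw [lift_smul, map_smul, hsum, smul_smul, inv_mul_cancel₀ hab, one_smul]
  -- (5) Fourier inversion at `1`: `|G| · k₀ = dᵢ · χᵢ`
  have hval : ∀ g, (Fintype.card G : ℂ) *
      (((φ (∑ g : G, MonoidAlgebra.single g (f g⁻¹)) i a b)⁻¹ • ∑ c, k c) g) =
        (d i : ℂ) * (blockRep φ i).character g := by
    intro g
    rw [card_mul_apply_eq_sum_trace φ _ g, hlift0, Finset.sum_eq_single i]
    · rw [Pi.single_eq_same, one_mul, character_blockRep_apply]
    · intro j _ hj
      rw [Pi.single_eq_of_ne hj, zero_mul, Matrix.trace_zero, mul_zero]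
    · exact fun h => absurd (Finset.mem_univ i) h
  have hd : (d i : ℂ) ≠ 0 := Nat.cast_ne_zero.mpr (NeZero.ne (d i))
  have hchar : (blockRep φ i).character = ((d i : ℂ)⁻¹ * Fintype.card G) •
      ((φ (∑ g : G, MonoidAlgebra.single g (f g⁻¹)) i a b)⁻¹ • ∑ c, k c) := by
    funext g
    rw [Pi.smul_apply, smul_eq_mul, mul_assoc, hval g, ← mul_assoc, inv_mul_cancel₀ hd, one_mul]
  rw [hchar]
  exact J.smul_mem _ (J.smul_mem _ hkJ')

end Summit.MatrixMultiplication.MatrixMultiplication.Theorems.GradedPricing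

end
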